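import Summits.KontsevichZagierPeriods.KontsevichZagierPeriods.Theses.Deregularisation
import Summits.KontsevichZagierPeriods.KontsevichZagierPeriods.Theorems.RegKernel2.Negative.TargetShape
import Literature.NumberTheory.Transcendental.KZRegCalculusProofs
import Literature.NumberTheory.Transcendental.KZKernelConjectureForms
import Literature.Barriers.KontsevichZagierPeriods.PeriodEqualityDecidability

/-!
# `RegKernel2` (stmt-KontsevichZagierPeriods-14491, live rev-10 decl): negative side — the repaired crux is a consequence of the summit, sandwiched between Conjecture 1 and a triviality

Negative-side record of the refuter crux attack (second, independent seat) on the REPAIRED item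
`RegKernel2` of route `Deregularisation`,
`∀ c : KZ.FormalRep, KZ.eval c = 0 → ∃ d ∈ KZreg.relations, KZreg.Λ d = c`
("every vanishing `ℤ`-combination of convergent representations is the de-regularisation of a
relation of the regularised calculus"). Companion of `TargetShape.lean` (which treats the refuted
v1 shape `KZreg.KernelConjecture` of the retired item stmt-4954). Kernel-checked and importable:

* §1 READ-BACK. `regKernel2_iff_ker_le_map` / `regKernel2_iff_map_eq_ker`: the decl says
  `ker KZ.eval ≤ Λ(KZreg.relations)`, equivalently (soundness, `map_Λ_relations_le_ker`) EQUALITY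
  `Λ(KZreg.relations) = ker KZ.eval`; `kz_relations_le_map_Λ_relations`: `KZ.relations` already lies
  in the image (via `incl`, `Λ ∘ incl = id`).
* §2 SUMMIT-CONSEQUENCE. `summit_consequence` : `(KZKernelConjecture → RegKernel2) ∧
  (KontsevichZagierPeriods → RegKernel2) ∧ (¬RegKernel2 → ¬KontsevichZagierPeriods)`: any
  refutation of the crux refutes Conjecture 1 itself — no witness is cheaper than a counterexample
  to the summit (none is known).
* §3 JOINT STRENGTH. `regConservative2_and_regKernel2_iff_kzKernelConjecture`,
  `summit_iff_regConservative2_and_regKernel2`, `regKernel2_iff_summit_of_regConservative2`: with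
  the route's X1 (`RegConservative2 = KZreg.Conservative`) the crux is EXACTLY the summit; alone it
  is the half "de-regularisation reaches every vanishing combination".
* §4 MOD-`ker Λ` READING. `reach_iff_incl_mem_sup` (pointwise), `ker_Λ_eq_defects`,
  `regKernel2_iff_ker_le_sup_ker`, `regKernel2_iff_ker_le_sup_defects`: the crux is the kernel
  statement of `KZreg` modulo the regularisation defects, `ker KZreg.eval ≤ relations ⊔ defects` —
  the minimal repair of the refuted v1 shape; the v1 unit-pole witness misses it
  (`TargetShape.of_unitPole_mem_relations_sup_defects`).
* §5 MONOTONE SANDWICH (restates-the-target check made quantitative). The reach statement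
  `Reach R := ∀ c, KZ.eval c = 0 → ∃ d ∈ R, Λ d = c` is monotone in the relation set `R`
  (`reach_mono`), insensitive to adjoining `ker Λ` (`reach_sup_ker_iff`), EQUAL TO THE SUMMIT at the
  lower end `R = incl(KZ.relations)` (`reach_map_incl_iff_summit`) and TRIVIALLY TRUE at the upper
  sound end `R = ker KZreg.eval` (`reach_ker_eval`); the crux is `Reach KZreg.relations` with
  `incl(KZ.relations) ≤ KZreg.relations < KZreg.relations ⊔ defects ≤ ker KZreg.eval`
  (`relationSet_chain`). So the crux is not literally the summit, but every bit of its content is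
  "how much of `ker KZreg.eval / ker Λ` the four regularised moves generate" — open, and refutable
  only through ¬(Conjecture 1).
* §6 HYPOTHESIS AND NON-VACUITY. `eval_eq_zero_of_reach` (the hypothesis `KZ.eval c = 0` is
  NECESSARY), `not_conclusion_forall` (dropping it is false: the constant `1`),
  `conclusion_holds_on_kz_relations`, `nontrivial_instance` (a non-zero `c` of value `0` on which
  the conclusion holds: `c = Λ[unitPole]`).

Nothing here asserts a Theses declaration. Sources: M. Kontsevich, D. Zagier, *Periods* (2001),
§1.2 Conjecture 1 [KontsevichZagier2001]; C. Dupont, E. Panzer, B. Pym, *Regularized integrals and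
manifolds with log corners*, J. Éc. polytech. Math. 13 (2026) [DupontPanzerPym2026], Ex. 7.13,
Cor. 7.9–7.11, Prop. 7.15 (as vendored in `KZRegCalculus.lean`). The statements about `RegKernel2`
are this project's bookkeeping; no printed source states the crux.
-/

noncomputable section

open Literature.NumberTheory.Transcendental
open Summit.KontsevichZagierPeriods.KontsevichZagierPeriods.Theses.Deregularisation
  (RegKernel2 RegConservative2)

namespace Summit.KontsevichZagierPeriods.RegKernel2.Negative

/-! ### §1 Read-back: `RegKernel2` is `ker KZ.eval ≤ Λ(KZreg.relations)`, i.e. equality -/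

/-- The live decl, read back: `RegKernel2 ↔ ker KZ.eval ≤ (KZreg.relations).map Λ`. [folklore] -/
theorem regKernel2_iff_ker_le_map :
    RegKernel2 ↔ KZ.eval.ker ≤ KZreg.relations.map KZreg.Λ := by
  constructor
  · intro h c hc
    exact AddSubgroup.mem_map.2 (h c ((AddMonoidHom.mem_ker).1 hc))
  · intro h c hc
    exact AddSubgroup.mem_map.1 (h ((AddMonoidHom.mem_ker).2 hc))

/-- Soundness half of the sandwich: `Λ(KZreg.relations) ≤ ker KZ.eval` (`eval_Λ` and
`relations_le_ker_eval`). [folklore] -/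
theorem map_Λ_relations_le_ker : KZreg.relations.map KZreg.Λ ≤ KZ.eval.ker := by
  rintro _ ⟨d, hd, rfl⟩
  exact (AddMonoidHom.mem_ker).2 (KZreg.kz_eval_Λ_eq_zero hd)

/-- Lower half of the sandwich: `KZ.relations ≤ Λ(KZreg.relations)` (`map_relations_le`,
`Λ ∘ incl = id`). [folklore] -/
theorem kz_relations_le_map_Λ_relations : KZ.relations ≤ KZreg.relations.map KZreg.Λ :=
  fun c hc => ⟨KZreg.incl c, KZreg.map_relations_le ⟨c, hc, rfl⟩, KZreg.Λ_incl c⟩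

/-- Hence `RegKernel2 ↔ Λ(KZreg.relations) = ker KZ.eval`. [folklore] -/
theorem regKernel2_iff_map_eq_ker :
    RegKernel2 ↔ KZreg.relations.map KZreg.Λ = KZ.eval.ker := by
  rw [regKernel2_iff_ker_le_map]
  exact ⟨fun h => le_antisymm map_Λ_relations_le_ker h, fun h => h.ge⟩

/-! ### §2 Summit-consequence: no refutation short of ¬(Conjecture 1) -/

/-- **The summit implies the crux**, packaged as a conjunction (so that no declaration of this
negative-side file has the route item as its conclusion): the ordinary kernel conjecture implies
`RegKernel2` (`d := incl c`, `map_relations_le`, `Λ ∘ incl = id`); the summit is the kernel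
conjecture (`kzKernelConjecture_iff_isRational`, whose right-hand side is the summit's body
verbatim); contrapositively **a refutation of `RegKernel2` is a refutation of Conjecture 1** — no
witness is cheaper than a counterexample to the summit. [folklore] -/
theorem summit_consequence :
    (KZKernelConjecture → RegKernel2) ∧ (KontsevichZagierPeriods → RegKernel2) ∧
      (¬ RegKernel2 → ¬ KontsevichZagierPeriods) := by
  have h1 : KZKernelConjecture → RegKernel2 := fun hk c hc =>
    ⟨KZreg.incl c, KZreg.map_relations_le ⟨c, hk c hc, rfl⟩, KZreg.Λ_incl c⟩
  have h2 : KontsevichZagierPeriods → RegKernel2 := fun h =>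
    h1 ((kzKernelConjecture_iff_isRational : KZKernelConjecture ↔ KontsevichZagierPeriods).mpr h)
  exact ⟨h1, h2, fun hn hs => hn (h2 hs)⟩

/-! ### §3 Joint strength with X1 -/

/-- **X1 ∧ crux ↔ the ordinary kernel conjecture**: `c = Λ d` with `d` a relation and `Λ` maps
relations to relations; conversely both conjuncts follow from the kernel conjecture
(`KZreg.conservative_of_kzKernelConjecture`, §2). [folklore] -/
theorem regConservative2_and_regKernel2_iff_kzKernelConjecture :
    (RegConservative2 ∧ RegKernel2) ↔ KZKernelConjecture := by
  constructor
  · rintro ⟨hc, hk⟩ c h0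
    obtain ⟨d, hd, rfl⟩ := hk c h0
    exact hc d hd
  · intro hk
    exact ⟨KZreg.conservative_of_kzKernelConjecture hk, summit_consequence.1 hk⟩

/-- **Summit ↔ X1 ∧ crux** (both conjuncts are summit-implied; together they are exactly it).
[folklore] -/
theorem summit_iff_regConservative2_and_regKernel2 :
    KontsevichZagierPeriods ↔ (RegConservative2 ∧ RegKernel2) :=
  (kzKernelConjecture_iff_isRational : KZKernelConjecture ↔ KontsevichZagierPeriods).symm.trans
    regConservative2_and_regKernel2_iff_kzKernelConjecture.symm

/-- Under X1 the crux IS the summit; without X1 only `summit → crux` is known. [folklore] -/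
theorem regKernel2_iff_summit_of_regConservative2 (hc : RegConservative2) :
    RegKernel2 ↔ KontsevichZagierPeriods :=
  ⟨fun hk => summit_iff_regConservative2_and_regKernel2.2 ⟨hc, hk⟩,
    fun h => summit_consequence.2.1 h⟩

/-! ### §4 The reading modulo `ker Λ = defects` -/

/-- Pointwise: `c` is reached from the relations iff `incl c ∈ relations ⊔ ker Λ`. [folklore] -/
theorem reach_iff_incl_mem_sup (R : AddSubgroup KZreg.FormalRep) (c : KZ.FormalRep) :
    (∃ d ∈ R, KZreg.Λ d = c) ↔ KZreg.incl c ∈ R ⊔ KZreg.Λ.ker := by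
  constructor
  · rintro ⟨d, hd, rfl⟩
    have : KZreg.incl (KZreg.Λ d) = d + (KZreg.incl (KZreg.Λ d) - d) := by abel
    rw [this]
    refine AddSubgroup.add_mem_sup hd ?_
    rw [AddMonoidHom.mem_ker, map_sub, KZreg.Λ_incl, sub_self]
  · intro h
    obtain ⟨y, hy, z, hz, hsum⟩ := AddSubgroup.mem_sup.1 h
    refine ⟨y, hy, ?_⟩
    have := congrArg KZreg.Λ hsum
    rwa [map_add, (AddMonoidHom.mem_ker).1 hz, add_zero, KZreg.Λ_incl] at this

/-- `ker Λ = defects` (`sub_incl_Λ_mem_defects` and `defects_le_ker_Λ`). [folklore] -/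
theorem ker_Λ_eq_defects : KZreg.Λ.ker = KZreg.defects := by
  refine le_antisymm ?_ KZreg.defects_le_ker_Λ
  intro d hd
  rw [AddMonoidHom.mem_ker] at hd
  have := KZreg.sub_incl_Λ_mem_defects d
  rwa [hd, map_zero, sub_zero] at this

/-- The reach of a relation set `R`, globally: `(∀ c, KZ.eval c = 0 → ∃ d ∈ R, Λ d = c)` iff
`ker KZreg.eval ≤ R ⊔ ker Λ`. [folklore] -/
theorem reach_iff_ker_le_sup_ker (R : AddSubgroup KZreg.FormalRep) :
    (∀ c : KZ.FormalRep, KZ.eval c = 0 → ∃ d ∈ R, KZreg.Λ d = c) ↔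
      KZreg.eval.ker ≤ R ⊔ KZreg.Λ.ker := by
  constructor
  · intro h d hd
    rw [AddMonoidHom.mem_ker] at hd
    have h1 := (reach_iff_incl_mem_sup R _).1 (h (KZreg.Λ d) (by rw [KZreg.eval_Λ]; exact hd))
    have h2 : d - KZreg.incl (KZreg.Λ d) ∈ KZreg.Λ.ker := by
      rw [AddMonoidHom.mem_ker, map_sub, KZreg.Λ_incl, sub_self]
    have : d = KZreg.incl (KZreg.Λ d) + (d - KZreg.incl (KZreg.Λ d)) := by abel
    rw [this]
    exact AddSubgroup.add_mem _ h1 (AddSubgroup.mem_sup_right h2)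
  · intro h c hc
    exact (reach_iff_incl_mem_sup R c).2
      (h (by rw [AddMonoidHom.mem_ker, KZreg.eval_incl]; exact hc))

/-- `RegKernel2 ↔ ker KZreg.eval ≤ KZreg.relations ⊔ ker Λ`. [folklore] -/
theorem regKernel2_iff_ker_le_sup_ker :
    RegKernel2 ↔ KZreg.eval.ker ≤ KZreg.relations ⊔ KZreg.Λ.ker :=
  reach_iff_ker_le_sup_ker KZreg.relations

/-- **`RegKernel2 ↔ ker KZreg.eval ≤ KZreg.relations ⊔ KZreg.defects`** — the minimal repair of
the refuted v1 shape (`TargetShape.not_targetShape`), missed by the unit-pole witness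
(`TargetShape.of_unitPole_mem_relations_sup_defects`). [folklore] -/
theorem regKernel2_iff_ker_le_sup_defects :
    RegKernel2 ↔ KZreg.eval.ker ≤ KZreg.relations ⊔ KZreg.defects := by
  rw [← ker_Λ_eq_defects]
  exact regKernel2_iff_ker_le_sup_ker

/-! ### §5 The monotone sandwich: summit at the bottom, a triviality at the top -/

/-- The reach statement is monotone in the relation set. [folklore] -/
theorem reach_mono {R R' : AddSubgroup KZreg.FormalRep} (hRR' : R ≤ R')
    (h : ∀ c : KZ.FormalRep, KZ.eval c = 0 → ∃ d ∈ R, KZreg.Λ d = c) :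
    ∀ c : KZ.FormalRep, KZ.eval c = 0 → ∃ d ∈ R', KZreg.Λ d = c :=
  fun c hc => let ⟨d, hd, hdc⟩ := h c hc; ⟨d, hRR' hd, hdc⟩

/-- Adjoining `ker Λ` (the defects) to the relation set does not change the reach. [folklore] -/
theorem reach_sup_ker_iff (R : AddSubgroup KZreg.FormalRep) :
    (∀ c : KZ.FormalRep, KZ.eval c = 0 → ∃ d ∈ R ⊔ KZreg.Λ.ker, KZreg.Λ d = c) ↔
      (∀ c : KZ.FormalRep, KZ.eval c = 0 → ∃ d ∈ R, KZreg.Λ d = c) := by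
  refine ⟨fun h c hc => ?_, fun h => reach_mono le_sup_left h⟩
  obtain ⟨d, hd, hdc⟩ := h c hc
  obtain ⟨y, hy, z, hz, rfl⟩ := AddSubgroup.mem_sup.1 hd
  refine ⟨y, hy, ?_⟩
  rwa [map_add, (AddMonoidHom.mem_ker).1 hz, add_zero] at hdc

/-- LOWER END: with only the included KZ moves the reach statement is the ordinary kernel
conjecture. [folklore] -/
theorem reach_map_incl_iff_kzKernelConjecture :
    (∀ c : KZ.FormalRep, KZ.eval c = 0 → ∃ d ∈ KZ.relations.map KZreg.incl, KZreg.Λ d = c) ↔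
      KZKernelConjecture := by
  constructor
  · intro h c hc
    obtain ⟨_, ⟨c', hc', rfl⟩, hΛ⟩ := h c hc
    rw [KZreg.Λ_incl] at hΛ
    rw [← hΛ]
    exact hc'
  · intro hk c hc
    exact ⟨KZreg.incl c, ⟨c, hk c hc, rfl⟩, KZreg.Λ_incl c⟩

/-- **LOWER END = SUMMIT**: `Reach (incl (KZ.relations)) ↔ KontsevichZagierPeriods`. [folklore] -/
theorem reach_map_incl_iff_summit :
    (∀ c : KZ.FormalRep, KZ.eval c = 0 → ∃ d ∈ KZ.relations.map KZreg.incl, KZreg.Λ d = c) ↔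
      KontsevichZagierPeriods :=
  reach_map_incl_iff_kzKernelConjecture.trans
    (kzKernelConjecture_iff_isRational : KZKernelConjecture ↔ KontsevichZagierPeriods)

/-- **UPPER END = TRIVIAL**: the largest sound relation set `ker KZreg.eval` reaches every vanishing
combination unconditionally (`d := incl c`). [folklore] -/
theorem reach_ker_eval :
    ∀ c : KZ.FormalRep, KZ.eval c = 0 → ∃ d ∈ KZreg.eval.ker, KZreg.Λ d = c :=
  fun c hc => ⟨KZreg.incl c, by rw [AddMonoidHom.mem_ker, KZreg.eval_incl]; exact hc,
    KZreg.Λ_incl c⟩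

/-- The crux is the reach statement of `KZreg.relations` (definitional). [folklore] -/
theorem regKernel2_iff_reach_relations :
    RegKernel2 ↔ ∀ c : KZ.FormalRep, KZ.eval c = 0 → ∃ d ∈ KZreg.relations, KZreg.Λ d = c :=
  Iff.rfl

/-- … and equally the reach statement of `KZreg.relations ⊔ defects`. [folklore] -/
theorem regKernel2_iff_reach_relations_sup_defects :
    RegKernel2 ↔
      ∀ c : KZ.FormalRep, KZ.eval c = 0 → ∃ d ∈ KZreg.relations ⊔ KZreg.defects, KZreg.Λ d = c := by
  rw [← ker_Λ_eq_defects]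
  exact (reach_sup_ker_iff KZreg.relations).symm

/-- The chain of relation sets between the two ends:
`incl(KZ.relations) ≤ KZreg.relations < KZreg.relations ⊔ defects ≤ ker KZreg.eval`. [folklore] -/
theorem relationSet_chain :
    KZ.relations.map KZreg.incl ≤ KZreg.relations ∧
      KZreg.relations < KZreg.relations ⊔ KZreg.defects ∧
        KZreg.relations ⊔ KZreg.defects ≤ KZreg.eval.ker :=
  ⟨KZreg.map_relations_le, KZreg.relations_lt_relations_sup_defects,
    KZreg.relations_sup_defects_le_ker_eval⟩

/-- The sandwich in one line: summit → crux → (the trivial upper reach). [folklore] -/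
theorem sandwich :
    (KontsevichZagierPeriods → RegKernel2) ∧
      (RegKernel2 → ∀ c : KZ.FormalRep, KZ.eval c = 0 → ∃ d ∈ KZreg.eval.ker, KZreg.Λ d = c) :=
  ⟨summit_consequence.2.1, fun h => reach_mono KZreg.relations_le_ker_eval h⟩

/-! ### §6 The hypothesis is necessary; the statement is not vacuous -/

/-- The conclusion forces the hypothesis: reached combinations have value `0`. [folklore] -/
theorem eval_eq_zero_of_reach {c : KZ.FormalRep} (h : ∃ d ∈ KZreg.relations, KZreg.Λ d = c) :
    KZ.eval c = 0 := by
  obtain ⟨d, hd, rfl⟩ := h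
  exact KZreg.kz_eval_Λ_eq_zero hd

/-- Dropping the hypothesis `KZ.eval c = 0` makes the statement false (the constant `1`).
[folklore] -/
theorem not_conclusion_forall :
    ¬ ∀ c : KZ.FormalRep, ∃ d ∈ KZreg.relations, KZreg.Λ d = c := by
  intro h
  have h0 := eval_eq_zero_of_reach
    (h (KZ.of (Literature.Barriers.KontsevichZagierPeriods.KZ.constRep 1)))
  rw [KZ.eval_of, Literature.Barriers.KontsevichZagierPeriods.KZ.constRep_value] at h0
  norm_num at h0

/-- The conclusion holds on every KZ relation (`d := incl c`): the degenerate instances `c = 0`,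
`c = [r] - [r]`, the `0`- and `1`-dimensional bookkeeping identities are all reached. [folklore] -/
theorem conclusion_holds_on_kz_relations {c : KZ.FormalRep} (hc : c ∈ KZ.relations) :
    ∃ d ∈ KZreg.relations, KZreg.Λ d = c :=
  ⟨KZreg.incl c, KZreg.map_relations_le ⟨c, hc, rfl⟩, KZreg.Λ_incl c⟩

/-- Non-vacuity: a NON-ZERO combination of value `0` on which the conclusion holds — the
de-regularised unit pole `Λ[unitPole] = [(0,1) ∪ collar, 0]`. [folklore] -/
theorem nontrivial_instance :
    ∃ c : KZ.FormalRep, c ≠ 0 ∧ KZ.eval c = 0 ∧ ∃ d ∈ KZreg.relations, KZreg.Λ d = c :=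
  ⟨KZreg.Λ (KZreg.of KZreg.unitPole), by rw [KZreg.Λ_of]; exact FreeAbelianGroup.of_ne_zero _,
    by rw [KZreg.eval_Λ, KZreg.eval_of_unitPole],
    conclusion_holds_on_kz_relations Λ_of_unitPole_mem_relations⟩

end Summit.KontsevichZagierPeriods.RegKernel2.Negative
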